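import Literature.NumberTheory.LFunctions.Zhang2022.RepairFormulaIGram

/-!
# Zhang (2022), repair rung F-S1R: the `ϰ`-profile of a mollifier component and the two dipole identities

Y. Zhang, arXiv:2211.02515v1 [Zhang2022LandauSiegel] — an unrefereed manuscript under adjudication; nothing here
asserts any of its claims. Track K-S1 of the repair rung (RULING R3), companion of `RepairFormulaIGram`.

A mollifier component `Σ_{n<P^ν} ψχ(n)n^{-s}(1 − log n/log P^ν)(P^ν/n)^{ikα}` ((2.23)–(2.25), real length
exponent `ν` and shift multiplier `k`, the fields `nu_μ`, `k_μ` of `Repair.Theta`) has the logarithmic profile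
`ϰ_{ν,k}(y) = (1 − y/ν)e^{iπk(ν−y)}𝟙_{y ≤ ν}` (`kappaP`; right derivative `kappaP'`; the linear taper makes it
continuous at `y = ν`). This file proves:
* `kappaP'_add_eq_ffT` — **dipole identity, `𝔣`-side**: `ϰ′ + iπjϰ = −(1/ν)·𝔣𝔣_{j,k}(ν − y)` on `y < ν`, with
  `𝔣𝔣_{j,k} = ffT k j` of `RepairTheta` (Lemma 8.2's main term at the main values);
* `integral_kappaP_tail` — `∫_y^1 ϰ = kappaTail ν k y` in closed form (`y ≤ ν ≤ 1`, `k ≠ 0`), and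
  `conj_kappa_gside_eq_ghT` — **dipole identity, `𝔤`-side**:
  `conj(ϰ′ + iπS_jϰ + π²N_j∫_y^1ϰ) = −(1/ν)·𝔤𝔥_{j,k}(ν − y)` with `𝔤𝔥_{j,k} = ghT k j` (Lemma 8.4's main term;
  the values `r₀ = N_j/k²`, `r₁ = 1 − r₀`, `b = S_j − k − N_j/k` come out of the tail integral);
* `kinkedProfile_kappaP` — `ϰ_{ν,k}` is a one-sided kinked (`H¹`) profile on `[0,1]` for `0 < ν ≤ 1`
  (`RepairFormulaIGram.KinkedProfile`; kink at `y = ν`), `kappaP_one : ϰ(1) = 0`.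
So the integrand of formula I on two `ϰ`-profiles is `(ν_aν_b)⁻¹𝔣𝔣_{j,k_a}(ν_a−y)𝔤𝔥_{j,k_b}(ν_b−y)` on the
common support — the displayed integrands of (8.19)–(8.22)/(9.3)–(9.6) (`RepairPairFormGram`). Elementary
calculus; `[cite: Zhang2022LandauSiegel, (2.23)–(2.25) p.9]` tags except for transcribed displays. No statement about Landau–Siegel zeros.
-/

noncomputable section

open Complex Real ComplexConjugate Set MeasureTheory intervalIntegral

namespace Literature.NumberTheory.LFunctions.Zhang2022

namespace Repair

/-! ### The `ϰ`-profile of one mollifier component and its right derivative -/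

/-- The logarithmic profile of one mollifier component `Σ_{n<P^ν} (1 − log n/log P^ν)(P^ν/n)^{ikα}`
((2.23)–(2.25)): `ϰ_{ν,k}(y) = (1 − y/ν)e^{iπk(ν−y)}` for `y ≤ ν`, `0` for `y > ν`
(`y = log n/log P`). [cite: Zhang2022LandauSiegel, (2.23)–(2.25)] -/
def kappaP (ν : ℝ) (k : ℝ) (y : ℝ) : ℂ :=
  if y ≤ ν then (((1 - y / ν : ℝ)) : ℂ) * cexp ((k : ℂ) * π * I * ((ν - y : ℝ) : ℂ)) else 0

/-- The right derivative of `ϰ_{ν,k}`: `−(1/ν)(1 + iπk(ν−y))e^{iπk(ν−y)}` for `y < ν`, `0` for `y ≥ ν`.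
[cite: Zhang2022LandauSiegel, (2.23)–(2.25)] -/
def kappaP' (ν : ℝ) (k : ℝ) (y : ℝ) : ℂ :=
  if y < ν then -(((1 / ν : ℝ)) : ℂ) * ((1 + (k : ℂ) * π * I * ((ν - y : ℝ) : ℂ))
    * cexp ((k : ℂ) * π * I * ((ν - y : ℝ) : ℂ))) else 0

/-- The tail integral `∫_y^ν ϰ_{ν,k}` in closed form (`k ≠ 0`):
`(1/ν)[e^{iπkw}(1/(π²k²) − iw/(πk)) − 1/(π²k²)]`, `w = ν − y`. [cite: Zhang2022LandauSiegel, (2.23)–(2.25) p.9] -/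
def kappaTail (ν : ℝ) (k : ℝ) (y : ℝ) : ℂ :=
  (((1 / ν : ℝ)) : ℂ) * (cexp ((k : ℂ) * π * I * ((ν - y : ℝ) : ℂ))
      * (1 / ((π : ℂ) * k) ^ 2 - I * ((ν - y : ℝ) : ℂ) / ((π : ℂ) * k)) - 1 / ((π : ℂ) * k) ^ 2)

variable {ν : ℝ} {k : ℝ}

/-- `ϰ` on its support. [cite: Zhang2022LandauSiegel, (2.23)–(2.25) p.9] -/
theorem kappaP_of_le {y : ℝ} (hy : y ≤ ν) :
    kappaP ν k y = (((1 - y / ν : ℝ)) : ℂ) * cexp ((k : ℂ) * π * I * ((ν - y : ℝ) : ℂ)) := by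
  simp [kappaP, hy]

/-- `ϰ` vanishes beyond its length. [cite: Zhang2022LandauSiegel, (2.23)–(2.25) p.9] -/
theorem kappaP_of_lt {y : ℝ} (hy : ν < y) : kappaP ν k y = 0 := by
  simp [kappaP, not_le.2 hy]

/-- `ϰ(ν) = 0` (the linear taper makes the truncation continuous). [cite: Zhang2022LandauSiegel, (2.23)–(2.25) p.9] -/
theorem kappaP_self (hν : ν ≠ 0) : kappaP ν k ν = 0 := by
  simp [kappaP, div_self hν]

/-- `ϰ = 0` on `[ν, ∞)`. [cite: Zhang2022LandauSiegel, (2.23)–(2.25) p.9] -/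
theorem kappaP_of_ge (hν : ν ≠ 0) {y : ℝ} (hy : ν ≤ y) : kappaP ν k y = 0 := by
  rcases hy.lt_or_eq with h | h
  · exact kappaP_of_lt h
  · rw [← h]; exact kappaP_self hν

/-- `ϰ′` on the support. [cite: Zhang2022LandauSiegel, (2.23)–(2.25) p.9] -/
theorem kappaP'_of_lt {y : ℝ} (hy : y < ν) :
    kappaP' ν k y = -(((1 / ν : ℝ)) : ℂ) * ((1 + (k : ℂ) * π * I * ((ν - y : ℝ) : ℂ))
      * cexp ((k : ℂ) * π * I * ((ν - y : ℝ) : ℂ))) := by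
  simp [kappaP', hy]

/-- `ϰ′ = 0` on `[ν, ∞)`. [cite: Zhang2022LandauSiegel, (2.23)–(2.25) p.9] -/
theorem kappaP'_of_ge {y : ℝ} (hy : ν ≤ y) : kappaP' ν k y = 0 := by
  simp [kappaP', not_lt.2 hy]

/-- **Dipole identity, `𝔣`-side**: on `y < ν`, `ϰ′ + iπj·ϰ = −(1/ν)·𝔣𝔣_{j,k}(ν − y)` with
`𝔣𝔣_{j,k} = ffT k j` (`RepairTheta`; Lemma 8.2's main term at the main values `β_j = ijα`, `β_μ = ikα`).
[cite: Zhang2022LandauSiegel, Lemma 8.2] -/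
theorem kappaP'_add_eq_ffT (hν : ν ≠ 0) (j : ℕ) {y : ℝ} (hy : y < ν) :
    kappaP' ν k y + I * π * (j : ℂ) * kappaP ν k y
      = -(((1 / ν : ℝ)) : ℂ) * ffT k j (ν - y) := by
  rw [kappaP'_of_lt hy, kappaP_of_le hy.le]
  unfold ffT ffR
  have hν' : (ν : ℂ) ≠ 0 := by exact_mod_cast hν
  push_cast
  field_simp
  ring


/-- The primitive used for the tail integral: `G(t) = (1/ν)e^{iπk(ν−t)}(i(ν−t)/(πk) − 1/(π²k²))`,
`G′ = ϰ` on `t < ν`. [cite: Zhang2022LandauSiegel, (2.23)–(2.25) p.9] -/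
private def kappaPrim (ν : ℝ) (k : ℝ) (t : ℝ) : ℂ :=
  (((1 / ν : ℝ)) : ℂ) * (cexp ((k : ℂ) * π * I * ((ν - t : ℝ) : ℂ))
      * (I * ((ν - t : ℝ) : ℂ) / ((π : ℂ) * k) - 1 / ((π : ℂ) * k) ^ 2))

/-- `G′(t) = (1 − t/ν)e^{iπk(ν−t)}` everywhere (`k ≠ 0`). [cite: Zhang2022LandauSiegel, (2.23)–(2.25) p.9] -/
private theorem hasDerivAt_kappaPrim (hν : ν ≠ 0) (hk : k ≠ 0) (t : ℝ) :
    HasDerivAt (kappaPrim ν k)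
      ((((1 - t / ν : ℝ)) : ℂ) * cexp ((k : ℂ) * π * I * ((ν - t : ℝ) : ℂ))) t := by
  have hπ : (π : ℂ) ≠ 0 := by exact_mod_cast Real.pi_ne_zero
  have hν' : (ν : ℂ) ≠ 0 := by exact_mod_cast hν
  have hk' : (k : ℂ) ≠ 0 := by exact_mod_cast hk
  have h1 : HasDerivAt (fun x : ℝ => ((ν - x : ℝ) : ℂ)) (-1) t := by
    have := ((hasDerivAt_id t).const_sub ν).ofReal_comp
    simpa using this
  have hE : HasDerivAt (fun x : ℝ => cexp ((k : ℂ) * π * I * ((ν - x : ℝ) : ℂ)))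
      (cexp ((k : ℂ) * π * I * ((ν - t : ℝ) : ℂ)) * ((k : ℂ) * π * I * (-1))) t :=
    (h1.const_mul ((k : ℂ) * π * I)).cexp
  have hL : HasDerivAt (fun x : ℝ => I * ((ν - x : ℝ) : ℂ) / ((π : ℂ) * k) - 1 / ((π : ℂ) * k) ^ 2)
      (I * (-1) / ((π : ℂ) * k)) t := by
    have := ((h1.const_mul I).div_const ((π : ℂ) * k)).sub_const (1 / ((π : ℂ) * k) ^ 2)
    simpa using this
  have h := (hE.mul hL).const_mul (((1 / ν : ℝ)) : ℂ)
  refine h.congr_deriv ?_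
  push_cast
  field_simp
  linear_combination (-(↑k : ℂ) * ↑π * ↑ν + ↑k * ↑π * ↑t) * Complex.I_sq

/-- `∫_y^ν ϰ_{ν,k} = kappaTail ν k y` for `y ≤ ν` (fundamental theorem of calculus). [cite: Zhang2022LandauSiegel, (2.23)–(2.25) p.9] -/
private theorem integral_kappaP_Icc (hν : ν ≠ 0) (hk : k ≠ 0) {y : ℝ} (hy : y ≤ ν) :
    ∫ t in y..ν, kappaP ν k t = kappaTail ν k y := by
  have e : ∫ t in y..ν, kappaP ν k t
      = ∫ t in y..ν, (((1 - t / ν : ℝ)) : ℂ) * cexp ((k : ℂ) * π * I * ((ν - t : ℝ) : ℂ)) := by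
    refine intervalIntegral.integral_congr fun t ht => ?_
    rw [uIcc_of_le hy] at ht
    exact kappaP_of_le ht.2
  rw [e, intervalIntegral.integral_eq_sub_of_hasDerivAt (fun t _ => hasDerivAt_kappaPrim hν hk t)
    ((Continuous.intervalIntegrable (by fun_prop) _ _))]
  unfold kappaPrim kappaTail
  push_cast
  simp only [sub_self, mul_zero, Complex.exp_zero, zero_div, zero_sub, one_mul]
  ring

/-- `∫_y^1 ϰ_{ν,k} = kappaTail ν k y` for `y ≤ ν ≤ 1` (the profile vanishes on `[ν,1]`). [cite: Zhang2022LandauSiegel, (2.23)–(2.25) p.9] -/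
theorem integral_kappaP_tail (hk : k ≠ 0) (hν : 0 < ν) (hν1 : ν ≤ 1) {y : ℝ} (hy : y ≤ ν) :
    ∫ t in y..1, kappaP ν k t = kappaTail ν k y := by
  have h0 : ∫ t in ν..1, kappaP ν k t = 0 := by
    rw [← intervalIntegral.integral_zero]
    refine intervalIntegral.integral_congr fun t ht => ?_
    rw [uIcc_of_le hν1] at ht
    exact kappaP_of_ge hν.ne' ht.1
  have hc : Continuous fun t : ℝ =>
      (((1 - t / ν : ℝ)) : ℂ) * cexp ((k : ℂ) * π * I * ((ν - t : ℝ) : ℂ)) := by fun_prop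
  have hi1 : IntervalIntegrable (kappaP ν k) volume y ν := by
    refine IntervalIntegrable.congr ?_ (hc.intervalIntegrable y ν)
    intro t ht
    rw [uIoc_of_le hy] at ht
    exact (kappaP_of_le ht.2).symm
  have hi2 : IntervalIntegrable (kappaP ν k) volume ν 1 := by
    refine IntervalIntegrable.congr ?_ (intervalIntegrable_const (c := (0:ℂ)))
    intro t ht
    rw [uIoc_of_le hν1] at ht
    exact (kappaP_of_ge hν.ne' ht.1.le).symm
  rw [← intervalIntegral.integral_add_adjacent_intervals hi1 hi2, h0, add_zero,
    integral_kappaP_Icc hν.ne' hk hy]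

/-- `∫_y^1 ϰ_{ν,k} = 0` for `ν ≤ y ≤ 1`. [cite: Zhang2022LandauSiegel, (2.23)–(2.25) p.9] -/
theorem integral_kappaP_tail_of_ge (hν : 0 < ν) {y : ℝ} (hy : ν ≤ y) (hy1 : y ≤ 1) :
    ∫ t in y..1, kappaP ν k t = 0 := by
  rw [← intervalIntegral.integral_zero]
  refine intervalIntegral.integral_congr fun t ht => ?_
  rw [uIcc_of_le hy1] at ht
  exact kappaP_of_ge hν.ne' (hy.trans ht.1)

/-- **Dipole identity, `𝔤`-side**: on `y < ν ≤ 1`,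
`conj(ϰ′ + iπS_j·ϰ + π²N_j·∫_y^1 ϰ) = −(1/ν)·𝔤𝔥_{j,k}(ν − y)` with `S_j = b_{j+1}+b_{j+2}` (`bS j`),
`N_j = b_{j+1}b_{j+2}` (`bN j`) and `𝔤𝔥_{j,k} = ghT k j` (`RepairTheta`; Lemma 8.4's main term at the main values).
[cite: Zhang2022LandauSiegel, Lemma 8.4] -/
theorem conj_kappa_gside_eq_ghT (hk : k ≠ 0) (hν : 0 < ν) (hν1 : ν ≤ 1) (j : ℕ) {y : ℝ}
    (hy : y < ν) :
    conj (kappaP' ν k y + I * π * ((bS j : ℝ) : ℂ) * kappaP ν k y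
        + (π : ℂ) ^ 2 * ((bN j : ℝ) : ℂ) * ∫ t in y..1, kappaP ν k t)
      = -(((1 / ν : ℝ)) : ℂ) * ghT k j (ν - y) := by
  rw [integral_kappaP_tail hk hν hν1 hy.le, kappaP'_of_lt hy, kappaP_of_le hy.le]
  unfold kappaTail ghT ghR
  have hν' : (ν : ℂ) ≠ 0 := by exact_mod_cast hν.ne'
  have hπ : (π : ℂ) ≠ 0 := by exact_mod_cast Real.pi_ne_zero
  have hk' : (k : ℂ) ≠ 0 := by exact_mod_cast hk
  have hE : conj (cexp ((k : ℂ) * π * I * ((ν - y : ℝ) : ℂ)))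
      = cexp (-((k : ℂ) * π * I * ((ν - y : ℝ) : ℂ))) := by
    rw [← Complex.exp_conj]
    congr 1
    simp [Complex.conj_ofReal]
  simp only [map_add, map_mul, map_sub, map_neg, map_div₀, map_one, map_pow, Complex.conj_ofReal,
    Complex.conj_I, hE]
  push_cast
  field_simp
  ring


/-! ### The `ϰ`-profiles are one-sided kinked profiles -/

section KappaProfile

variable {ν : ℝ} {k : ℝ}

/-- The smooth formula behind `ϰ`. [cite: Zhang2022LandauSiegel, (2.23)–(2.25) p.9] -/
private theorem hasDerivAt_kappaFormula (hν : ν ≠ 0) (x : ℝ) :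
    HasDerivAt (fun y : ℝ => (((1 - y / ν : ℝ)) : ℂ) * cexp ((k : ℂ) * π * I * ((ν - y : ℝ) : ℂ)))
      (-(((1 / ν : ℝ)) : ℂ) * ((1 + (k : ℂ) * π * I * ((ν - x : ℝ) : ℂ))
        * cexp ((k : ℂ) * π * I * ((ν - x : ℝ) : ℂ)))) x := by
  have hν' : (ν : ℂ) ≠ 0 := by exact_mod_cast hν
  have h1 : HasDerivAt (fun y : ℝ => ((ν - y : ℝ) : ℂ)) (-1) x := by
    have := ((hasDerivAt_id x).const_sub ν).ofReal_comp
    simpa using this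
  have h2 : HasDerivAt (fun y : ℝ => (((1 - y / ν : ℝ)) : ℂ)) (-(1 / ν : ℂ)) x := by
    have := (((hasDerivAt_id x).div_const ν).const_sub 1).ofReal_comp
    simpa using this
  have hE : HasDerivAt (fun y : ℝ => cexp ((k : ℂ) * π * I * ((ν - y : ℝ) : ℂ)))
      (cexp ((k : ℂ) * π * I * ((ν - x : ℝ) : ℂ)) * ((k : ℂ) * π * I * (-1))) x :=
    (h1.const_mul ((k : ℂ) * π * I)).cexp
  refine (h2.mul hE).congr_deriv ?_
  push_cast
  field_simp
  ring

/-- `ϰ_{ν,k}` is a kinked profile on `[0,1]` for `0 < ν ≤ 1` (right derivative `ϰ′`, kink at `y = ν`).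
[cite: Zhang2022LandauSiegel, (2.23)–(2.25)] -/
theorem kinkedProfile_kappaP (hν : 0 < ν) (hν1 : ν ≤ 1) : KinkedProfile (kappaP ν k) (kappaP' ν k) where
  cont := by
    have hform : Continuous fun y : ℝ =>
        (((1 - y / ν : ℝ)) : ℂ) * cexp ((k : ℂ) * π * I * ((ν - y : ℝ) : ℂ)) := by fun_prop
    -- `ϰ = formula` on `(-∞, ν]`, `0` on `[ν, ∞)`, both continuous and agreeing at `ν`
    have key : Continuous (kappaP ν k) := by
      have e : kappaP ν k = fun y => if y ≤ ν then
          (((1 - y / ν : ℝ)) : ℂ) * cexp ((k : ℂ) * π * I * ((ν - y : ℝ) : ℂ)) else 0 := rfl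
      rw [e]
      refine Continuous.if_le hform continuous_const continuous_id continuous_const ?_
      intro y hy
      rw [hy, div_self hν.ne']
      simp
    exact key.continuousOn
  hasDeriv := by
    intro x hx
    by_cases hxν : x < ν
    · -- interior of the support: genuine derivative of the formula
      have hd := hasDerivAt_kappaFormula (k := k) hν.ne' x
      have heq : ∀ᶠ y in nhds x, kappaP ν k y
          = (((1 - y / ν : ℝ)) : ℂ) * cexp ((k : ℂ) * π * I * ((ν - y : ℝ) : ℂ)) := by
        filter_upwards [Iio_mem_nhds hxν] with y hy using kappaP_of_le (le_of_lt hy)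
      rw [kappaP'_of_lt hxν]
      exact (hd.congr_of_eventuallyEq heq).hasDerivWithinAt
    · -- on `[ν, 1)`: `ϰ = 0` to the right
      rw [kappaP'_of_ge (not_lt.1 hxν)]
      refine (hasDerivWithinAt_const x (Ioi x) (0:ℂ)).congr (fun y hy => ?_) ?_
      · exact kappaP_of_ge hν.ne' ((not_lt.1 hxν).trans (le_of_lt hy))
      · exact kappaP_of_ge hν.ne' (not_lt.1 hxν)
  memLp := by
    -- bounded measurable
    have hmeas : AEStronglyMeasurable (kappaP' ν k) (volume.restrict (Ioc (0:ℝ) 1)) := by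
      have hform : Continuous fun y : ℝ => -(((1 / ν : ℝ)) : ℂ) * ((1 + (k : ℂ) * π * I * ((ν - y : ℝ) : ℂ))
          * cexp ((k : ℂ) * π * I * ((ν - y : ℝ) : ℂ))) := by fun_prop
      have e : kappaP' ν k = Set.piecewise (Iio ν) (fun y => -(((1 / ν : ℝ)) : ℂ)
          * ((1 + (k : ℂ) * π * I * ((ν - y : ℝ) : ℂ)) * cexp ((k : ℂ) * π * I * ((ν - y : ℝ) : ℂ))))
          (fun _ => 0) := by
        funext y
        by_cases hy : y < ν
        · rw [Set.piecewise_eq_of_mem _ _ _ (by exact hy), kappaP'_of_lt hy]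
        · rw [Set.piecewise_eq_of_notMem _ _ _ (by exact hy), kappaP'_of_ge (not_lt.1 hy)]
      rw [e]
      exact (hform.measurable.piecewise measurableSet_Iio measurable_const).aestronglyMeasurable
    refine MemLp.of_bound hmeas (1 / ν * (1 + |k| * π * 1)) ?_
    refine (ae_restrict_iff' measurableSet_Ioc).2 (ae_of_all _ fun y hy => ?_)
    by_cases hyν : y < ν
    · rw [kappaP'_of_lt hyν]
      have hw0 : 0 ≤ ν - y := by linarith
      have hw1 : ν - y ≤ 1 := by linarith [hy.1]
      rw [norm_mul, norm_neg, norm_mul, Complex.norm_real, Complex.norm_exp]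
      have hre : ((k : ℂ) * π * I * ((ν - y : ℝ) : ℂ)).re = 0 := by
        simp [Complex.mul_re, Complex.mul_im]
      rw [hre, Real.exp_zero, mul_one, Real.norm_eq_abs, abs_of_pos (one_div_pos.2 hν)]
      refine mul_le_mul_of_nonneg_left ?_ (one_div_pos.2 hν).le
      calc ‖(1 : ℂ) + (k : ℂ) * π * I * ((ν - y : ℝ) : ℂ)‖
          ≤ ‖(1 : ℂ)‖ + ‖(k : ℂ) * π * I * ((ν - y : ℝ) : ℂ)‖ := norm_add_le _ _
        _ = 1 + |k| * π * (ν - y) := by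
            rw [norm_one, norm_mul, norm_mul, norm_mul, Complex.norm_I, mul_one, Complex.norm_real,
              Complex.norm_real, Complex.norm_real, Real.norm_eq_abs, Real.norm_eq_abs, Real.norm_eq_abs,
              abs_of_pos Real.pi_pos, abs_of_nonneg hw0]
        _ ≤ 1 + |k| * π * 1 := by gcongr
    · rw [kappaP'_of_ge (not_lt.1 hyν), norm_zero]
      positivity

/-- `ϰ_{ν,k}(1) = 0` for `ν ≤ 1`. [cite: Zhang2022LandauSiegel, (2.23)–(2.25) p.9] -/
theorem kappaP_one (hν : 0 < ν) (hν1 : ν ≤ 1) : kappaP ν k 1 = 0 := kappaP_of_ge hν.ne' hν1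

end KappaProfile

end Repair

end Literature.NumberTheory.LFunctions.Zhang2022
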